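import Summits.RiemannHypothesis.RiemannHypothesis.Theorems.WeilColumnThetaWitness
import Summits.RiemannHypothesis.RiemannHypothesis.Theorems.WeilColumnBSplineContinuity
import Summits.RiemannHypothesis.RiemannHypothesis.Theorems.WeilColumnThetaMellinZeros
import HarnessLib

/-!
# (Z1) FOR THE WITNESS: `weilMellin (oddProfile P.Θ) ρ = 0` at every nontrivial zero of `ζ` — hypothesis-free (RH-FREE)

WEIL column (LADDER-RH, W-P(P2); tier-1 `ThetaCertificateSound`, THETA-ASSIGN §6 Step 2). The capstone `WeilColumnThetaMellinZeros`
(p418484) needs `ProfileHyp G` and `ThetaBoundedNearZero G`; for the witness `G = P.G` the first is the profile's support/continuity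
(handoff-prove-2's `continuous_profile_of_two_le`, p421408) and the second follows from D1 ALONE (`‖Θ u‖ ≤ M(u/u₁)^m ≤ M` on `(0, u₁)`,
`ThetaParams.norm_Θ_le`, p418783) — no Lipschitz constant needed. Results: `ThetaParams.thetaBoundedNearZero`,
`ThetaParams.mellinConvergent_Θ` (`Re z > 0`), **`ThetaParams.weilMellin_oddProfile_Θ_eq_zero`**: the odd theta profile `G₀⁻` of every
admissible row is Weil–Mellin-ORTHOGONAL to every nontrivial zero. RH-free; nothing here bears on the truth of RH.
-/

set_option linter.dupNamespace false

noncomputable section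

open MeasureTheory Set Complex Filter
open scoped Real
open Literature.NumberTheory.LFunctions

namespace Summit.RiemannHypothesis.RiemannHypothesis.Theorems.WeilColumn.ThetaMellin

namespace ThetaParams

variable (P : ThetaParams)

/-- `ProfileHyp` for the witness (local copy of the argument; the named version lives in `WeilColumnThetaWitnessBasics`). -/
private theorem profileHyp_G_aux {qn : ℕ} (hP : P.Admissible qn) : ProfileHyp P.G (P.lam * P.c₁) (P.lam * P.c₂) := by
  have hm2 : 2 ≤ P.m := le_trans (by norm_num) hP.three_le
  have hm : 1 ≤ P.m := le_trans (by norm_num) hm2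
  have hε : 0 < P.ε := by have := hP.delta_pos; have := hP.c₂_pos; unfold ε; positivity
  have hlam : 0 < P.lam := by have := hP.c₂_pos; unfold lam; positivity
  have hle : P.c₁ ≤ P.c₂ := by linarith [hP.seed₁, hP.seed₂]
  have hcont : Continuous P.h := continuous_profile_of_two_le hm2 hε
  refine ⟨hcont.comp (continuous_id.div_const _), mul_pos hlam hP.c₁_pos, mul_le_mul_of_nonneg_left hle hlam.le, fun t ht => ?_⟩
  refine Function.notMem_support.mp fun hmem => ht ?_
  have hsub := support_profile_subset (α := P.α) hm hε.le hP.seed₂.le hP.seed₁.le hmem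
  exact ⟨by have := (le_div_iff₀ hlam).mp hsub.1; linarith, by have := (div_le_iff₀ hlam).mp hsub.2; linarith⟩

/-- **The witness theta series is bounded near `0`** — from D1 alone: `‖Θ u‖ ≤ M` on `(0, u₁)`. [this seat] -/
theorem thetaBoundedNearZero {qn : ℕ} (hP : P.Admissible qn) : ThetaBoundedNearZero P.G := by
  have hm2 : 2 ≤ P.m := le_trans (by norm_num) hP.three_le
  have hε : 0 < P.ε := by have := hP.delta_pos; have := hP.c₂_pos; unfold ε; positivity
  have hcont : Continuous P.h := continuous_profile_of_two_le hm2 hε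
  have hu₁ : 0 < P.u₁ := Real.exp_pos _
  refine ⟨P.M, P.u₁, hu₁, fun t ht => ?_⟩
  have h := P.norm_Θ_le hP hcont ht.1
  have hM : 0 ≤ P.M := by
    have h1 := P.norm_Θ_le hP hcont hu₁
    rw [div_self hu₁.ne', one_pow, mul_one] at h1
    exact (norm_nonneg _).trans h1
  have hle : (t / P.u₁) ^ P.m ≤ 1 := pow_le_one₀ (div_nonneg ht.1.le hu₁.le) ((div_le_one hu₁).mpr ht.2.le)
  calc ‖thetaSum P.G t‖ = ‖P.Θ t‖ := rfl
    _ ≤ P.M * (t / P.u₁) ^ P.m := h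
    _ ≤ P.M * 1 := mul_le_mul_of_nonneg_left hle hM
    _ = P.M := mul_one _

/-- The witness theta series is Mellin-summable on `Re z > 0`. [this seat] -/
theorem mellinConvergent_Θ {qn : ℕ} (hP : P.Admissible qn) {z : ℂ} (hz : 0 < z.re) : MellinConvergent P.Θ z :=
  (P.profileHyp_G_aux hP).mellinConvergent_thetaSum (P.thetaBoundedNearZero hP) hz

/-- `∫ G = 0` for the witness (`∫ h = 0` by the choice of `α`, scaled by `λ`). [this seat] -/
theorem integral_G_eq_zero {qn : ℕ} (hP : P.Admissible qn) : ∫ y, P.G y = 0 := by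
  have hlam : 0 < P.lam := by have := hP.c₂_pos; unfold lam; positivity
  have h0 : ∫ y, P.h y = 0 := integral_profile_eq_zero hP.seed₂.le hP.seed₁ rfl
  have e : P.G = fun y => P.h (P.lam⁻¹ * y) := by funext y; simp [G, div_eq_inv_mul]
  rw [e, MeasureTheory.Measure.integral_comp_mul_left (fun y => P.h y) P.lam⁻¹, h0, smul_zero]

/-- **(Z1) FOR THE WITNESS**: at every nontrivial zero `ρ` of `ζ` (`0 < Re ρ < 1`), `weilMellin (oddProfile P.Θ) ρ = 0`. [this seat] -/
theorem weilMellin_oddProfile_Θ_eq_zero {qn : ℕ} (hP : P.Admissible qn) {ρ : ℂ} (hζ : riemannZeta ρ = 0)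
    (h0 : 0 < ρ.re) (h1 : ρ.re < 1) : weilMellin (oddProfile P.Θ) ρ = 0 := by
  have hG := P.profileHyp_G_aux hP
  have hb := P.thetaBoundedNearZero hP
  have h0' : 0 < (1 - ρ).re := by simp; linarith
  have h1' : (1 - ρ).re < 1 := by simp; linarith
  have hζ' : riemannZeta (1 - ρ) = 0 := Literature.NumberTheory.LFunctions.GeneralizedRH.riemannZeta_one_sub_eq_zero hζ h0 h1
  exact weilMellin_oddProfile_eq_zero _ (hG.mellinConvergent_thetaSum hb h0) (hG.mellinConvergent_thetaSum hb h0')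
    (hG.mellin_thetaSum_eq_zero_of_zeta_zero hb hζ h0 h1) (hG.mellin_thetaSum_eq_zero_of_zeta_zero hb hζ' h0' h1')

end ThetaParams

end Summit.RiemannHypothesis.RiemannHypothesis.Theorems.WeilColumn.ThetaMellin
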